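import Mathlib
import Literature.NumberTheory.LFunctions.Zhang2022.TypedSection14
import Literature.NumberTheory.LFunctions.Zhang2022.Section7Eq75Majorants
import Literature.NumberTheory.LFunctions.Zhang2022.Section3Lemma33
import HarnessLib

/-!
# Zhang (2022) §14, (14.3): the critical-line core of the extension `Ψ₁ → Ψ` (Hölder, large sieve, divisor moments, Prop. 2.1)

Topic `Literature/NumberTheory/LFunctions/Zhang2022` (Landau–Siegel adjudication tree; verdict-neutral;
cell siegel-zhang, toward the DAG deduction node `Z22:(14.3)` = `Typed.Sec14.DedEq143`).
Y. Zhang, *Discrete mean estimates and the Landau–Siegel zero*, arXiv:2211.02515v1 (2022)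
[Zhang2022LandauSiegel] — **an unrefereed manuscript under adjudication; nothing here bears on its
Theorems 1–2 or on Landau–Siegel zeros.** §14 p. 76 (tex L3849–L3855): "Similar to the proof of
Proposition 7.1 … we can extend the sum over `Ψ₁` to the sum over `Ψ`, with acceptable errors. Namely
`Θ₂ = Σ_{ψ∈Ψ} Ĩ₂(ψ) + o(𝔓)` (14.3)"; the method is the display proving (7.5), §7 p. 35: "by Cauchy's
inequality, `≤ (Σ_Ψ|Σ_{m<P²}…|²)^{1/2}(Σ_Ψ|A|⁴)^{1/4}(Σ_{Ψ₂}1)^{1/4} ≪ (P²Στ₅²/m)^{1/2}(P²Στ₂²/m)^{1/4}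
(Σ_{Ψ₂}1)^{1/4}`. This yields (7.5) by Proposition 2.1 and (2.9)."

This file PROVES the (14.3)-instance of that display (theorems only; no new definition, no named fact),
GIVEN Proposition 2.1 and Lemma 3.3 (ii) — the antecedents `Skeleton.Prop21`, `Skeleton.Lemma33b` of
`Typed.Sec14.DedEq143` (both theorems of the tree: `Skeleton.prop21_holds`, `Skeleton.lemma33b_holds`):
`Typed.Sec14.Eq143.core` — for `κ*` with `|κ*| ≤ Bτ₅` ((14.1), `Typed.Sec14.Eq141`) and `a*` with
`|a*| ≤ B` ((14.2), `Typed.Sec14.Eq142`), on `Re s = ½`, eventually in `D` and under (A):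
`Σ_{ψ∈Ψ₂} |Σ_{m≤P²} κ*(m)ψ(m)m^{−s}|·|Σ_{n≤2P₄} a*(n)ψ̄(n)n^{s−1}| ≤ K·𝔓·𝓛⁻⁵`. Route, every exponent
visible: `X⁴ ≤ U²V·#Ψ₂` (`pow_four_le`); `U ≤ C₃₃P²B²·majorantConst 25 10·(2𝓛⁹)²⁵`
(`sum_sq_kappaPoly_le`: Lemma 3.3 (ii) + `MeanSquareMajorant.sum_tau_sq_div_le 5`);
`V = Σ_Ψ|A²|² ≤ C₃₃P²max(B,0)⁴·majorantConst 4 4·(2𝓛⁹)⁴` (`sum_pow_four_aPoly_le`: `A²` is a polynomial of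
length `⌊2P₄⌋² ≤ P²` with coefficients `≪ B²τ₂`, `Section7Eq75.sq_dirPoly_eq`); `#Ψ₂ ≤ C₂₁𝔓𝓛⁻⁷³⁹`;
`P² ≤ 2𝔓𝓛⁷⁷` (`bigP_sq_le`, from the tree's `frakP_bounds` = (2.9)) — so `X⁴ ≤ c𝔓⁴𝓛⁻²²`. The two
contour-shift legs of (14.3) (`𝔍(1) → 𝔍(0)`, and `𝔍(1) → 𝔍(𝓛⁹)` for the tail `m > P²`) are not here.

## References

* Y. Zhang, arXiv:2211.02515v1 (2022), §14 (14.3) p. 76; §7 (7.5) p. 35; §2 (2.9).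
  [cite: Zhang2022LandauSiegel, §14 (14.3) p. 76]
-/

noncomputable section

open Finset Complex Real ComplexConjugate

namespace Literature.NumberTheory.LFunctions.Zhang2022.Typed.Sec14.Eq143

open Skeleton MeanSquareMajorant Section7Eq75

/-! ### Bookkeeping -/

/-- For a finite set, `finsetOf S` has `S.ncard` elements (the count `Σ_{ψ∈Ψ₂} 1` of Proposition 2.1 as
the cardinality of the skeleton's `finsetOf Ψ₂`). [cite: Zhang2022LandauSiegel, §2 Prop. 2.1 p. 6] -/
theorem card_finsetOf {α : Type*} {S : Set α} (h : S.Finite) : (finsetOf S).card = S.ncard := by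
  rw [finsetOf, dif_pos h, Set.ncard_eq_toFinset_card S h]

/-- **`c𝓛ᵏ ≤ T` eventually** (`T = exp 𝓛^{1.1}`, `𝓛 = log D`): since `𝓛^{k+1} ≤ (k+1)!·e^{𝓛} = (k+1)!·D`
and `e^{𝓛} ≤ e^{𝓛^{1.1}}` for `𝓛 ≥ 1`, one has `c𝓛ᵏ ≤ T` as soon as `𝓛 ≥ c(k+1)!` (and `𝓛 ≥ 1`).
[cite: Zhang2022LandauSiegel, §6 p. 30 (`T = exp 𝓛^{1.1}`)] -/
theorem pow_le_bigT (k : ℕ) (c : ℝ) : ∃ D₀ : ℕ, ∀ D : ℕ, D₀ ≤ D → c * ell D ^ k ≤ bigT D := by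
  obtain ⟨D₀, hD₀⟩ := exists_nat_le_ell (max 1 (c * (k + 1).factorial))
  refine ⟨D₀, fun D hD => ?_⟩
  have hℓ := hD₀ D hD
  have hℓ1 : 1 ≤ ell D := le_trans (le_max_left _ _) hℓ
  have hℓc : c * (k + 1).factorial ≤ ell D := le_trans (le_max_right _ _) hℓ
  have hℓ0 : 0 < ell D := by linarith
  have hT : Real.exp (ell D) ≤ bigT D := by
    rw [bigT]
    exact Real.exp_le_exp.mpr (by
      simpa using Real.rpow_le_rpow_of_exponent_le hℓ1 (by norm_num : (1 : ℝ) ≤ 1.1))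
  refine le_trans ?_ hT
  have h1 : ell D ^ (k + 1) ≤ (k + 1).factorial * Real.exp (ell D) := by
    have := Real.pow_div_factorial_le_exp (ell D) hℓ0.le (k + 1)
    rwa [div_le_iff₀ (by exact_mod_cast Nat.factorial_pos _), mul_comm] at this
  rcases le_or_gt c 0 with hc | hc
  · exact le_trans (mul_nonpos_of_nonpos_of_nonneg hc (pow_nonneg hℓ0.le _)) (Real.exp_pos _).le
  · -- `c𝓛ᵏ · 𝓛 ≤ c (k+1)! e^{𝓛} ≤ 𝓛 e^{𝓛}`
    have h2 : c * ell D ^ k * ell D ≤ Real.exp (ell D) * ell D := by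
      calc c * ell D ^ k * ell D = c * ell D ^ (k + 1) := by ring
        _ ≤ c * ((k + 1).factorial * Real.exp (ell D)) := mul_le_mul_of_nonneg_left h1 hc.le
        _ = (c * (k + 1).factorial) * Real.exp (ell D) := by ring
        _ ≤ ell D * Real.exp (ell D) := mul_le_mul_of_nonneg_right hℓc (Real.exp_pos _).le
        _ = Real.exp (ell D) * ell D := mul_comm _ _
    exact le_of_mul_le_mul_right h2 hℓ0

/-- **`P² ≤ 2𝔓𝓛⁷⁷` eventually** — from (2.9) in the tree's quantitative form
`|𝔓 − P²𝓛⁻⁷⁷| ≤ 3𝓛⁻⁶⁸·P²𝓛⁻⁷⁷` (`Zhang2022.frakP_bounds`): `P²𝓛⁻⁷⁷ ≤ 2𝔓` once `3𝓛⁻⁶⁸ ≤ ½`.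
[cite: Zhang2022LandauSiegel, §2 (2.9)] -/
theorem bigP_sq_le : ∃ D₀ : ℕ, ∀ D : ℕ, D₀ ≤ D → bigP D ^ 2 ≤ 2 * frakP D * ell D ^ 77 := by
  obtain ⟨D₀, hD₀⟩ := frakP_bounds
  obtain ⟨D₁, hD₁⟩ := exists_nat_le_ell 2
  refine ⟨max D₀ D₁, fun D hD => ?_⟩
  have hb := hD₀ D (le_trans (le_max_left _ _) hD)
  have hℓ2 : 2 ≤ ell D := hD₁ D (le_trans (le_max_right _ _) hD)
  have hℓ0 : 0 < ell D := by linarith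
  set Q : ℝ := Real.exp (Real.log D ^ 9) ^ 2 with hQ
  have hPQ : bigP D ^ 2 = Q := by rw [hQ, bigP, ell]
  have hQ0 : 0 < Q := by positivity
  have h68 : 3 * (ell D ^ 68)⁻¹ ≤ 1 / 2 := by
    rw [← one_div, mul_one_div, div_le_div_iff₀ (by positivity) (by norm_num)]
    have : (2 : ℝ) ^ 68 ≤ ell D ^ 68 := pow_le_pow_left₀ (by norm_num) hℓ2 68
    nlinarith
  have hM0 : 0 ≤ Q * (ell D ^ 77)⁻¹ := by positivity
  have hlow : Q * (ell D ^ 77)⁻¹ ≤ 2 * frakP D := by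
    have h1 := (abs_le.mp hb).1
    simp only [ell] at h68 hM0 ⊢
    nlinarith [mul_le_mul_of_nonneg_right h68 hM0]
  rw [hPQ]
  have h77 : 0 < ell D ^ 77 := pow_pos hℓ0 77
  calc Q = Q * (ell D ^ 77)⁻¹ * ell D ^ 77 := by field_simp
    _ ≤ 2 * frakP D * ell D ^ 77 := mul_le_mul_of_nonneg_right hlow h77.le

/-- Cauchy's inequality twice: `(Σ_S uv)⁴ ≤ (Σ_T u²)²·(Σ_T v⁴)·#S` for `S ⊆ T`, `u, v ≥ 0` — the
"by Cauchy's inequality" step of (7.5) in fourth-power form (cf. `Section7Eq75.sum_mul_le_holder`),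
free of real exponents. [cite: Zhang2022LandauSiegel, §7 (7.5) p. 35] -/
theorem pow_four_le {ι : Type*} (S T : Finset ι) (hST : S ⊆ T) (u v : ι → ℝ)
    (hu : ∀ i, 0 ≤ u i) (hv : ∀ i, 0 ≤ v i) :
    (∑ i ∈ S, u i * v i) ^ 4 ≤ (∑ i ∈ T, u i ^ 2) ^ 2 * ((∑ i ∈ T, v i ^ 4) * S.card) := by
  have h1 : (∑ i ∈ S, u i * v i) ^ 2 ≤ (∑ i ∈ S, u i ^ 2) * (∑ i ∈ S, v i ^ 2) :=
    Finset.sum_mul_sq_le_sq_mul_sq S u v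
  have h2 : (∑ i ∈ S, v i ^ 2) ^ 2 ≤ (∑ i ∈ S, v i ^ 4) * S.card := by
    have h := Finset.sum_mul_sq_le_sq_mul_sq S (fun i => v i ^ 2) (fun _ => (1 : ℝ))
    simp only [mul_one, one_pow, Finset.sum_const, nsmul_eq_mul] at h
    calc (∑ i ∈ S, v i ^ 2) ^ 2 ≤ (∑ i ∈ S, (v i ^ 2) ^ 2) * (S.card : ℝ) := h
      _ = (∑ i ∈ S, v i ^ 4) * S.card := by
          congr 1; exact Finset.sum_congr rfl fun i _ => by ring
  have hA : ∑ i ∈ S, u i ^ 2 ≤ ∑ i ∈ T, u i ^ 2 :=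
    Finset.sum_le_sum_of_subset_of_nonneg hST fun i _ _ => sq_nonneg _
  have hB : ∑ i ∈ S, v i ^ 4 ≤ ∑ i ∈ T, v i ^ 4 :=
    Finset.sum_le_sum_of_subset_of_nonneg hST fun i _ _ => by positivity
  have hSu : 0 ≤ ∑ i ∈ S, u i ^ 2 := Finset.sum_nonneg fun i _ => sq_nonneg _
  have hX : 0 ≤ ∑ i ∈ S, u i * v i := Finset.sum_nonneg fun i _ => mul_nonneg (hu i) (hv i)
  calc (∑ i ∈ S, u i * v i) ^ 4 = ((∑ i ∈ S, u i * v i) ^ 2) ^ 2 := by ring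
    _ ≤ ((∑ i ∈ S, u i ^ 2) * (∑ i ∈ S, v i ^ 2)) ^ 2 := pow_le_pow_left₀ (sq_nonneg _) h1 2
    _ = (∑ i ∈ S, u i ^ 2) ^ 2 * (∑ i ∈ S, v i ^ 2) ^ 2 := by ring
    _ ≤ (∑ i ∈ T, u i ^ 2) ^ 2 * ((∑ i ∈ S, v i ^ 4) * S.card) :=
        mul_le_mul (pow_le_pow_left₀ hSu hA 2) h2 (sq_nonneg _) (by positivity)
    _ ≤ (∑ i ∈ T, u i ^ 2) ^ 2 * ((∑ i ∈ T, v i ^ 4) * S.card) := by gcongr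

/-- `⌊2P₄⌋² ≤ ⌊P²⌋` eventually (`P₄ = PT⁻²t₀`, so `(2P₄)² = P²·(2t₀/T²)² ≤ P²` once `2t₀ ≤ T ≤ T²`):
the square of the `a*`-polynomial of (14.3) has length within the large sieve's `P²`
(cf. "`A(𝐚₂;1−s,ψ̄)²` has length `< P²T⁻⁴`" in (7.5)). [cite: Zhang2022LandauSiegel, §7 (7.5) p. 35] -/
theorem floor_two_P4_sq_le : ∃ D₀ : ℕ, ∀ D : ℕ, D₀ ≤ D →
    ⌊2 * P4 D⌋₊ * ⌊2 * P4 D⌋₊ ≤ ⌊bigP D ^ 2⌋₊ := by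
  obtain ⟨D₀, hD₀⟩ := pow_le_bigT 519 2
  obtain ⟨D₁, hD₁⟩ := exists_nat_le_ell 1
  refine ⟨max D₀ D₁, fun D hD => ?_⟩
  have ht : 2 * ell D ^ 519 ≤ bigT D := hD₀ D (le_trans (le_max_left _ _) hD)
  have hℓ1 : 1 ≤ ell D := hD₁ D (le_trans (le_max_right _ _) hD)
  have hT1 : 1 ≤ bigT D := by rw [bigT]; exact Real.one_le_exp (by positivity)
  have hT0 : 0 < bigT D := by linarith
  have hP0 : 0 < bigP D := Real.exp_pos _
  have ht0 : 0 ≤ t0 D := by rw [t0]; positivity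
  have hP4 : 0 ≤ 2 * P4 D := by rw [P4]; positivity
  have h2P4 : 2 * P4 D ≤ bigP D := by
    rw [P4, t0]
    have h1 : 2 * ell D ^ 519 ≤ bigT D ^ 2 := ht.trans (by nlinarith)
    rw [show 2 * (bigP D / bigT D ^ 2 * ell D ^ 519) = bigP D * (2 * ell D ^ 519) / bigT D ^ 2 by
      ring, div_le_iff₀ (by positivity)]
    exact mul_le_mul_of_nonneg_left h1 hP0.le
  refine Nat.le_floor ?_
  push_cast
  calc (⌊2 * P4 D⌋₊ : ℝ) * ⌊2 * P4 D⌋₊ ≤ (2 * P4 D) * (2 * P4 D) :=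
        mul_le_mul (Nat.floor_le hP4) (Nat.floor_le hP4) (Nat.cast_nonneg _) hP4
    _ ≤ bigP D * bigP D := mul_le_mul h2P4 h2P4 hP4 hP0.le
    _ = bigP D ^ 2 := (sq _).symm

/-- `2 ≤ ⌊P²⌋` and `log ⌊P²⌋ ≤ 2𝓛⁹` once `𝓛 ≥ 1` (`P = exp 𝓛⁹`). [cite: Zhang2022LandauSiegel, §2 (2.6)] -/
theorem floor_bigP_sq_facts {D : ℕ} (hℓ : 1 ≤ ell D) :
    2 ≤ ⌊bigP D ^ 2⌋₊ ∧ Real.log (⌊bigP D ^ 2⌋₊ : ℝ) ≤ 2 * ell D ^ 9 := by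
  have hP2 : bigP D ^ 2 = Real.exp (2 * ell D ^ 9) := by
    rw [bigP, ← Real.exp_nat_mul]; norm_num
  have h2 : (2 : ℝ) ≤ bigP D ^ 2 := by
    rw [hP2]
    have h1 : (2 : ℝ) ≤ 2 * ell D ^ 9 := by nlinarith [one_le_pow₀ (n := 9) hℓ]
    linarith [Real.add_one_le_exp (2 * ell D ^ 9)]
  have hfl : 2 ≤ ⌊bigP D ^ 2⌋₊ := Nat.le_floor (by exact_mod_cast h2)
  refine ⟨hfl, ?_⟩
  have hpos : (0 : ℝ) < ⌊bigP D ^ 2⌋₊ := by exact_mod_cast (by omega : 0 < ⌊bigP D ^ 2⌋₊)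
  calc Real.log (⌊bigP D ^ 2⌋₊ : ℝ) ≤ Real.log (bigP D ^ 2) :=
        Real.log_le_log hpos (Nat.floor_le (by positivity))
    _ = 2 * ell D ^ 9 := by rw [hP2, Real.log_exp]

/-- `τ₅ = ζ⁵` as a real arithmetic function is the cast of `ζ⁵` as an `ℕ`-valued one (the shape of
(14.1) in `Typed.Sec14.Eq141`). [folklore] -/
private theorem tau_eq_natCast (j n : ℕ) :
    tau j n = (((ArithmeticFunction.zeta ^ j : ArithmeticFunction ℕ)) n : ℝ) := by
  have h : ∀ i : ℕ, ((ArithmeticFunction.zeta ^ i : ArithmeticFunction ℕ) : ArithmeticFunction ℝ) =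
      (ArithmeticFunction.zeta : ArithmeticFunction ℝ) ^ i := by
    intro i
    induction i with
    | zero => rw [pow_zero, pow_zero, ArithmeticFunction.natCoe_one]
    | succ i ih => rw [pow_succ, pow_succ, ArithmeticFunction.natCoe_mul, ih]
  rw [tau, ← h, ArithmeticFunction.natCoe_apply]

/-! ### The second moment of the `κ*`-polynomial (large sieve + `τ₅`-moment) -/

/-- **`Σ_{ψ∈Ψ}|Σ_{m≤P²} κ*(m)ψ(m)m^{−s}|² ≤ C₃₃P²·B²·majorantConst 25 10·(2𝓛⁹)²⁵`** on `Re s = ½`, for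
`|κ*| ≤ Bτ₅` (14.1): Lemma 3.3 (ii) and `Σ_{m≤X}τ₅(m)²/m ≤ majorantConst 25 10 (log X)²⁵`, `log⌊P²⌋ ≤ 2𝓛⁹`.
[cite: Zhang2022LandauSiegel, §7 (7.5) p. 35; §14 (14.3) p. 76] -/
theorem sum_sq_kappaPoly_le {D : ℕ} [Fintype (Chr D)] (hℓ : 1 ≤ ell D) {C₃₃ : ℝ}
    (h33 : ∀ (s : ℂ) (c : ℕ → ℂ),
      ∑ᶠ x : Chr D, ‖∑ n ∈ Icc 1 ⌊bigP D ^ 2⌋₊, c n * x.ψ (n : ZMod x.p) * (n : ℂ) ^ (-s)‖ ^ 2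
        ≤ C₃₃ * bigP D ^ 2 * ∑ n ∈ Icc 1 ⌊bigP D ^ 2⌋₊, ‖c n‖ ^ 2 * (n : ℝ) ^ (-2 * s.re))
    {B : ℝ} {κs : ℕ → ℂ} (hκ : Eq141 B κs) {s : ℂ} (hs : s.re = 1 / 2) :
    ∑ x : Chr D, ‖∑ m ∈ Icc 1 ⌊bigP D ^ 2⌋₊, κs m * x.ψ (m : ZMod x.p) * (m : ℂ) ^ (-s)‖ ^ 2 ≤
      max C₃₃ 0 * bigP D ^ 2 * (B ^ 2 * (majorantConst 25 10 * (2 * ell D ^ 9) ^ 25)) := by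
  obtain ⟨hX, hlog⟩ := floor_bigP_sq_facts hℓ
  set X : ℕ := ⌊bigP D ^ 2⌋₊ with hXdef
  have key := h33 s κs
  rw [finsum_eq_sum_of_fintype, hs] at key
  have hW : ∑ n ∈ Icc 1 X, ‖κs n‖ ^ 2 * (n : ℝ) ^ (-2 * (1 / 2 : ℝ)) =
      ∑ n ∈ Icc 1 X, ‖κs n‖ ^ 2 / n := by
    refine sum_congr rfl fun n _ => ?_
    rw [show -2 * (1 / 2 : ℝ) = -1 by norm_num, Real.rpow_neg_one, div_eq_mul_inv]
  rw [hW] at key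
  have hτ := sum_tau_sq_div_le 5 hX
  norm_num at hτ
  have hW1 : ∑ n ∈ Icc 1 X, ‖κs n‖ ^ 2 / n ≤ B ^ 2 * ∑ n ∈ Icc 1 X, tau 5 n ^ 2 / n := by
    rw [mul_sum]
    refine sum_le_sum fun n _ => ?_
    have h1 : ‖κs n‖ ≤ B * tau 5 n := by rw [tau_eq_natCast]; exact hκ n
    have h2 : ‖κs n‖ ^ 2 ≤ (B * tau 5 n) ^ 2 := pow_le_pow_left₀ (norm_nonneg _) h1 2
    rw [mul_div_assoc', ← mul_pow]
    exact div_le_div_of_nonneg_right h2 (Nat.cast_nonneg n)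
  have hM := majorantConst_pos 25 10; have hlog0 : 0 ≤ Real.log (X : ℝ) := Real.log_natCast_nonneg X
  have hW2 : ∑ n ∈ Icc 1 X, tau 5 n ^ 2 / n ≤ majorantConst 25 10 * (2 * ell D ^ 9) ^ 25 :=
    hτ.trans (mul_le_mul_of_nonneg_left (pow_le_pow_left₀ hlog0 hlog 25) hM.le)
  have hW0 : 0 ≤ ∑ n ∈ Icc 1 X, ‖κs n‖ ^ 2 / n := sum_nonneg fun n _ => by positivity
  have hP : 0 ≤ bigP D ^ 2 := sq_nonneg _
  calc ∑ x : Chr D, ‖∑ m ∈ Icc 1 X, κs m * x.ψ (m : ZMod x.p) * (m : ℂ) ^ (-s)‖ ^ 2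
      ≤ C₃₃ * bigP D ^ 2 * ∑ n ∈ Icc 1 X, ‖κs n‖ ^ 2 / n := key
    _ ≤ max C₃₃ 0 * bigP D ^ 2 * ∑ n ∈ Icc 1 X, ‖κs n‖ ^ 2 / n := by
        gcongr; exact le_max_left _ _
    _ ≤ max C₃₃ 0 * bigP D ^ 2 * (B ^ 2 * (majorantConst 25 10 * (2 * ell D ^ 9) ^ 25)) := by
        refine mul_le_mul_of_nonneg_left (hW1.trans ?_) (mul_nonneg (le_max_right _ _) hP)
        exact mul_le_mul_of_nonneg_left hW2 (sq_nonneg _)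

/-! ### The fourth moment of the `a*`-polynomial (its square is a polynomial of length `≤ P²`) -/

/-- **`Σ_{ψ∈Ψ}|Σ_{n≤2P₄} a*(n)ψ̄(n)n^{s−1}|⁴ ≤ C₃₃P²·max(B,0)⁴·majorantConst 4 4·(2𝓛⁹)⁴`** on `Re s = ½`, for
`|a*| ≤ B` (14.2), once `⌊2P₄⌋² ≤ ⌊P²⌋`: the square is `Σ_{k≤P²}(a′⋆a′)(k)ψ̄(k)k^{s−1}` (`sq_dirPoly_eq`),
`|(a′⋆a′)(k)| ≤ max(B,0)²τ₂(k)`, the large sieve after conjugation, `Σ_{k≤X}τ₂(k)²/k ≪ (log X)⁴`.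
[cite: Zhang2022LandauSiegel, §7 (7.5) p. 35; §14 (14.3) p. 76] -/
theorem sum_pow_four_aPoly_le {D : ℕ} [Fintype (Chr D)] (hℓ : 1 ≤ ell D)
    (hN : ⌊2 * P4 D⌋₊ * ⌊2 * P4 D⌋₊ ≤ ⌊bigP D ^ 2⌋₊) {C₃₃ : ℝ}
    (h33 : ∀ (s : ℂ) (c : ℕ → ℂ),
      ∑ᶠ x : Chr D, ‖∑ n ∈ Icc 1 ⌊bigP D ^ 2⌋₊, c n * x.ψ (n : ZMod x.p) * (n : ℂ) ^ (-s)‖ ^ 2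
        ≤ C₃₃ * bigP D ^ 2 * ∑ n ∈ Icc 1 ⌊bigP D ^ 2⌋₊, ‖c n‖ ^ 2 * (n : ℝ) ^ (-2 * s.re))
    {B : ℝ} {as : ℕ → ℂ} (ha : ∀ n : ℕ, ‖as n‖ ≤ B) {s : ℂ} (hs : s.re = 1 / 2) :
    ∑ x : Chr D, ‖∑ n ∈ Icc 1 ⌊2 * P4 D⌋₊,
        as n * conj (x.ψ (n : ZMod x.p)) * (n : ℂ) ^ (s - 1)‖ ^ 4 ≤
      max C₃₃ 0 * bigP D ^ 2 * (max B 0 ^ 4 * (majorantConst 4 4 * (2 * ell D ^ 9) ^ 4)) := by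
  obtain ⟨hX, hlog⟩ := floor_bigP_sq_facts hℓ
  set X : ℕ := ⌊bigP D ^ 2⌋₊ with hXdef
  set N : ℕ := ⌊2 * P4 D⌋₊ with hNdef
  set w : ℂ := 1 - s with hw
  set a' : ℕ → ℂ := fun n => if n < N + 1 then as n else 0 with ha'
  set b : ℕ → ℂ := seqConv a' a' with hb
  have hsq : ∀ x : Chr D,
      (∑ n ∈ Icc 1 N, as n * conj (x.ψ (n : ZMod x.p)) * (n : ℂ) ^ (s - 1)) ^ 2 =
        ∑ k ∈ Icc 1 X, b k * conj (x.ψ (k : ZMod x.p)) * (k : ℂ) ^ (-w) := by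
    intro x
    have hθ0 : conj (x.ψ ((0 : ℕ) : ZMod x.p)) = 0 := by
      rw [Nat.cast_zero, MulChar.map_nonunit _ not_isUnit_zero, map_zero]
    have hθ : ∀ m n : ℕ, conj (x.ψ ((m * n : ℕ) : ZMod x.p)) =
        conj (x.ψ (m : ZMod x.p)) * conj (x.ψ (n : ZMod x.p)) := by
      intro m n; rw [Nat.cast_mul, map_mul, map_mul]
    have key := sq_dirPoly_eq (N + 1) X (by simpa using hN) as
      (fun n => conj (x.ψ (n : ZMod x.p))) hθ0 hθ w
    have hrange : ∑ n ∈ Finset.range (N + 1), as n * conj (x.ψ (n : ZMod x.p)) * (n : ℂ) ^ (-w) =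
        ∑ n ∈ Icc 1 N, as n * conj (x.ψ (n : ZMod x.p)) * (n : ℂ) ^ (s - 1) := by
      rw [Finset.range_eq_Ico, Finset.sum_eq_sum_Ico_succ_bot (Nat.succ_pos N), hθ0, mul_zero,
        zero_mul, zero_add]
      refine sum_congr (by ext n; simp only [Finset.mem_Ico, Finset.mem_Icc]; omega) fun n _ => ?_
      rw [hw, neg_sub, show s - 1 = -(1 - s) by ring, neg_sub]
    rw [← hrange, key]
  have hconj : ∀ x : Chr D,
      ‖∑ k ∈ Icc 1 X, b k * conj (x.ψ (k : ZMod x.p)) * (k : ℂ) ^ (-w)‖ =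
        ‖∑ k ∈ Icc 1 X, conj (b k) * x.ψ (k : ZMod x.p) * (k : ℂ) ^ (-conj w)‖ := by
    intro x
    rw [← Complex.norm_conj, map_sum]
    congr 1
    refine sum_congr rfl fun k _ => ?_
    have hk : conj ((k : ℂ) ^ (-w)) = (k : ℂ) ^ (-conj w) := by
      rw [← map_neg, Complex.cpow_conj _ _ (by rw [Complex.natCast_arg]; exact Real.pi_ne_zero.symm),
        Complex.conj_natCast]
    rw [map_mul, map_mul, Complex.conj_conj, hk]
  have key := h33 (conj w) (fun k => conj (b k))
  rw [finsum_eq_sum_of_fintype] at key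
  have hre : -2 * (conj w).re = -1 := by
    rw [Complex.conj_re, hw, Complex.sub_re, Complex.one_re, hs]; norm_num
  rw [hre] at key
  simp only [Complex.norm_conj, Real.rpow_neg_one] at key
  have hab : ∀ n, n ≠ 0 → ‖a' n‖ ≤ max B 0 := fun n _ => norm_truncSeq_le ha n
  have hmom := sum_norm_seqConv_sq_div_le hab hX
  have hM : 0 < majorantConst 4 4 := majorantConst_pos _ _
  have hlog0 : 0 ≤ Real.log (X : ℝ) := Real.log_natCast_nonneg X
  have hB0 : 0 ≤ max B 0 := le_max_right _ _
  have hmom' : ∑ k ∈ Icc 1 X, ‖b k‖ ^ 2 * (k : ℝ)⁻¹ ≤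
      max B 0 ^ 4 * (majorantConst 4 4 * (2 * ell D ^ 9) ^ 4) := by
    simp only [← div_eq_mul_inv]
    exact hmom.trans (mul_le_mul_of_nonneg_left
      (mul_le_mul_of_nonneg_left (pow_le_pow_left₀ hlog0 hlog 4) hM.le) (by positivity))
  have hW0 : 0 ≤ ∑ k ∈ Icc 1 X, ‖b k‖ ^ 2 * (k : ℝ)⁻¹ := sum_nonneg fun k _ => by positivity
  calc ∑ x : Chr D, ‖∑ n ∈ Icc 1 N, as n * conj (x.ψ (n : ZMod x.p)) * (n : ℂ) ^ (s - 1)‖ ^ 4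
      = ∑ x : Chr D, ‖∑ k ∈ Icc 1 X, conj (b k) * x.ψ (k : ZMod x.p) * (k : ℂ) ^ (-conj w)‖ ^ 2 := by
        refine sum_congr rfl fun x _ => ?_
        rw [show (4 : ℕ) = 2 * 2 by norm_num, pow_mul, ← norm_pow, hsq x, hconj x]
    _ ≤ C₃₃ * bigP D ^ 2 * ∑ k ∈ Icc 1 X, ‖b k‖ ^ 2 * (k : ℝ)⁻¹ := key
    _ ≤ max C₃₃ 0 * bigP D ^ 2 * ∑ k ∈ Icc 1 X, ‖b k‖ ^ 2 * (k : ℝ)⁻¹ := by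
        gcongr; exact le_max_left _ _
    _ ≤ max C₃₃ 0 * bigP D ^ 2 * (max B 0 ^ 4 * (majorantConst 4 4 * (2 * ell D ^ 9) ^ 4)) :=
        mul_le_mul_of_nonneg_left hmom' (mul_nonneg (le_max_right _ _) (sq_nonneg _))

/-! ### The core bound on the critical line -/

/-- **The (14.3)-instance of the display proving (7.5)**: GIVEN Proposition 2.1 and Lemma 3.3 (ii), for
every `B` there is `K` such that for all large `D`, every real primitive `χ (mod D)` with (A), all
`κ*, a*` subject to (14.1)–(14.2) with constant `B`, and every `s` with `Re s = ½`:
`Σ_{ψ∈Ψ₂} |Σ_{m≤P²} κ*(m)ψ(m)m^{−s}|·|Σ_{n≤2P₄} a*(n)ψ̄(n)n^{s−1}| ≤ K·𝔓·𝓛⁻⁵`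
(`X⁴ ≤ U²V·#Ψ₂ ≤ (c_UP²𝓛²²⁵)²(c_VP²𝓛³⁶)(C₂₁𝔓𝓛⁻⁷³⁹)`, `P² ≤ 2𝔓𝓛⁷⁷` ⇒ `X⁴ ≤ c𝔓⁴𝓛⁻²²`).
[cite: Zhang2022LandauSiegel, §14 (14.3) p. 76; §7 (7.5) p. 35] -/
theorem core (h21 : Prop21) (h33b : Lemma33b) (B : ℝ) :
    ∃ K : ℝ, ForAllLarge fun D _ χ => AssumptionA D χ → ∀ κs as : ℕ → ℂ,
      Eq141 B κs → Eq142 D B as → ∀ s : ℂ, s.re = 1 / 2 →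
        ∑ x ∈ finsetOf (PsiTwo χ),
          ‖∑ m ∈ Icc 1 ⌊bigP D ^ 2⌋₊, κs m * x.ψ (m : ZMod x.p) * (m : ℂ) ^ (-s)‖ *
            ‖∑ n ∈ Icc 1 ⌊2 * P4 D⌋₊, as n * conj (x.ψ (n : ZMod x.p)) * (n : ℂ) ^ (s - 1)‖ ≤
          K * frakP D * (ell D ^ 5)⁻¹ := by
  obtain ⟨C₂₁, D₁, hD₁⟩ := h21
  obtain ⟨C₃₃, h33⟩ := h33b
  set cU : ℝ := max C₃₃ 0 * (B ^ 2 * (majorantConst 25 10 * 2 ^ 25)) with hcU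
  set cV : ℝ := max C₃₃ 0 * (max B 0 ^ 4 * (majorantConst 4 4 * 2 ^ 4)) with hcV
  set c : ℝ := 8 * cU ^ 2 * cV * max C₂₁ 0 with hc
  have hM25 := majorantConst_pos 25 10; have hM4 := majorantConst_pos 4 4
  have hcU0 : 0 ≤ cU := by positivity
  have hcV0 : 0 ≤ cV := by positivity
  have hc0 : 0 ≤ c := by positivity
  refine ⟨1 + c, ?_⟩
  obtain ⟨D₂, hD₂⟩ := bigP_sq_le
  obtain ⟨D₃, hD₃⟩ := floor_two_P4_sq_le
  obtain ⟨D₄, hD₄⟩ := exists_nat_le_ell 1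
  refine ⟨max (max D₁ D₂) (max D₃ D₄), fun D _ χ hD hq hp hA κs as hκ ha s hs => ?_⟩
  simp only [max_le_iff] at hD
  obtain ⟨⟨hD₁', hD₂'⟩, hD₃', hD₄'⟩ := hD
  have hℓ : 1 ≤ ell D := hD₄ D hD₄'; have hℓ0 : 0 < ell D := by linarith
  haveI : Fintype (Chr D) := Fintype.ofFinite _
  set ℓ : ℝ := ell D with hℓdef; set Pf : ℝ := frakP D with hPf
  have hPf0 : 0 ≤ Pf := by
    rw [hPf, frakP_eq_sum_primeWindow]; exact sum_nonneg fun p _ => Nat.cast_nonneg p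
  have hU := sum_sq_kappaPoly_le hℓ (h33 D) hκ hs
  have hV := sum_pow_four_aPoly_le hℓ (hD₃ D hD₃') (h33 D) ha.1 hs
  have hS : ((finsetOf (PsiTwo χ)).card : ℝ) ≤ max C₂₁ 0 * Pf * (ℓ ^ 739)⁻¹ := by
    rw [card_finsetOf (Set.toFinite _)]
    refine (hD₁ D χ hD₁' hq hp hA).trans ?_
    exact mul_le_mul_of_nonneg_right (mul_le_mul_of_nonneg_right (le_max_left _ _) hPf0)
      (inv_nonneg.mpr (pow_nonneg hℓ0.le _))
  have hP2 : bigP D ^ 2 ≤ 2 * Pf * ℓ ^ 77 := hD₂ D hD₂'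
  have hP20 : 0 ≤ bigP D ^ 2 := sq_nonneg _
  have hU' : ∑ x : Chr D, ‖∑ m ∈ Icc 1 ⌊bigP D ^ 2⌋₊, κs m * x.ψ (m : ZMod x.p) * (m : ℂ) ^ (-s)‖ ^ 2
      ≤ cU * bigP D ^ 2 * ℓ ^ 225 := by
    refine hU.trans (le_of_eq ?_); rw [hcU]; ring
  have hV' : ∑ x : Chr D, ‖∑ n ∈ Icc 1 ⌊2 * P4 D⌋₊,
      as n * conj (x.ψ (n : ZMod x.p)) * (n : ℂ) ^ (s - 1)‖ ^ 4 ≤ cV * bigP D ^ 2 * ℓ ^ 36 := by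
    refine hV.trans (le_of_eq ?_); rw [hcV]; ring
  have hX4 := pow_four_le (finsetOf (PsiTwo χ)) Finset.univ (Finset.subset_univ _)
    (fun x : Chr D => ‖∑ m ∈ Icc 1 ⌊bigP D ^ 2⌋₊, κs m * x.ψ (m : ZMod x.p) * (m : ℂ) ^ (-s)‖)
    (fun x : Chr D => ‖∑ n ∈ Icc 1 ⌊2 * P4 D⌋₊,
      as n * conj (x.ψ (n : ZMod x.p)) * (n : ℂ) ^ (s - 1)‖)
    (fun _ => norm_nonneg _) (fun _ => norm_nonneg _)
  have hUn : 0 ≤ ∑ x : Chr D,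
      ‖∑ m ∈ Icc 1 ⌊bigP D ^ 2⌋₊, κs m * x.ψ (m : ZMod x.p) * (m : ℂ) ^ (-s)‖ ^ 2 :=
    sum_nonneg fun x _ => sq_nonneg _
  have hVn : 0 ≤ ∑ x : Chr D, ‖∑ n ∈ Icc 1 ⌊2 * P4 D⌋₊,
      as n * conj (x.ψ (n : ZMod x.p)) * (n : ℂ) ^ (s - 1)‖ ^ 4 :=
    sum_nonneg fun x _ => by positivity
  have h1 := hX4.trans (mul_le_mul (pow_le_pow_left₀ hUn hU' 2) (mul_le_mul hV' hS (Nat.cast_nonneg _)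
    (hVn.trans hV')) (mul_nonneg hVn (Nat.cast_nonneg _)) (sq_nonneg _))
  have h2 : (cU * bigP D ^ 2 * ℓ ^ 225) ^ 2 *
      ((cV * bigP D ^ 2 * ℓ ^ 36) * (max C₂₁ 0 * Pf * (ℓ ^ 739)⁻¹)) ≤
      (cU * (2 * Pf * ℓ ^ 77) * ℓ ^ 225) ^ 2 *
        ((cV * (2 * Pf * ℓ ^ 77) * ℓ ^ 36) * (max C₂₁ 0 * Pf * (ℓ ^ 739)⁻¹)) := by
    have : 0 ≤ (ℓ ^ 739)⁻¹ := inv_nonneg.mpr (pow_nonneg hℓ0.le _)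
    gcongr
  have h3 : (cU * (2 * Pf * ℓ ^ 77) * ℓ ^ 225) ^ 2 *
      ((cV * (2 * Pf * ℓ ^ 77) * ℓ ^ 36) * (max C₂₁ 0 * Pf * (ℓ ^ 739)⁻¹)) =
      c * Pf ^ 4 * (ℓ ^ 22)⁻¹ := by
    rw [hc]; field_simp; ring
  have h4 : c * Pf ^ 4 * (ℓ ^ 22)⁻¹ ≤ ((1 + c) * Pf * (ℓ ^ 5)⁻¹) ^ 4 := by
    have hK : c ≤ (1 + c) ^ 4 :=
      (le_add_of_nonneg_left zero_le_one).trans (le_self_pow₀ (by linarith) (by norm_num))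
    have hℓinv : (ℓ ^ 22)⁻¹ ≤ (ℓ ^ 20)⁻¹ :=
      inv_anti₀ (pow_pos hℓ0 _) (pow_le_pow_right₀ hℓ (by norm_num))
    calc c * Pf ^ 4 * (ℓ ^ 22)⁻¹ ≤ (1 + c) ^ 4 * Pf ^ 4 * (ℓ ^ 20)⁻¹ := by
          gcongr
      _ = ((1 + c) * Pf * (ℓ ^ 5)⁻¹) ^ 4 := by rw [mul_pow, mul_pow, inv_pow, ← pow_mul]
  have hK0 : 0 ≤ (1 + c) * Pf * (ℓ ^ 5)⁻¹ := by positivity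
  exact le_of_pow_le_pow_left₀ (by norm_num) hK0 (h1.trans (h2.trans (h3.le.trans h4)))

end Literature.NumberTheory.LFunctions.Zhang2022.Typed.Sec14.Eq143

end
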